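import Summits.CriticalPhenomena.CardyFormulaZ2.Theorems.CardyMagicRigidityNestingRigidityNeckFourArmInputsT
import Summits.CriticalPhenomena.CardyFormulaZ2.Theorems.CardyMagicRigidityNestingRigidityPinchLocality
import Summits.CriticalPhenomena.CardyFormulaZ2.Theorems.CardyMagicRigidityNestingRigidityTPinchAlternation
import Literature.Probability.Percolation.ArmEventsAPriori
import Literature.Probability.Percolation.TriAnnulusCircuit
import HarnessLib

/-!
# The selection event `TPinch 0 0 s s` from two open crossing clusters without a disjoint third closed crossing

Crux `Summit.CriticalPhenomena.CardyFormulaZ2.Theses.CardyMagicRigidity.NestingRigidity` (stmt-CriticalPhenomena-4835),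
line `pinch-resampling` v4, stub S11 `stub_neckHookupCoarseT`, input (I0) `TPinchPositive`.  The DETERMINISTIC half of
the positivity of `TPinch 0 0 s s` (exactly two open and exactly two closed crossing clusters of the collar
`Λ_{2s} ∖ Λ_s = {s+1 ≤ |·|_𝕋 ≤ 2s}`), phrased with the tree events `T = TFourArmTwoClusters 0 n N` (two open crossings
of `{n ≤ |·| ≤ N}` in distinct open clusters of it, `…NeckFourArmInputsT`) and `C = armEvent ![false] n N` (a closed
crossing of it):

* **`TPinchPos.mem_disjointOccurrence_of_third`** — on `T`, a closed crossing not joined (by closed paths of the annulus)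
  to the two frontier chains of `exists_frontierChains_alternating` makes `T □ C` occur DISJOINTLY: the two open
  crossings and the two closed chains CERTIFY `T` (an open junction would interleave, on `∂Λ_N`, with the closed-and-hole
  path through the chains, `triBall_not_interleaved_shift`), the third crossing certifies `C`, and the witness sets are
  disjoint.
* **`TPinchPos.tPinch_zero_of_not_mem_disjointOccurrence`** (anchor `tPinch_zero_of_twoClusters`) — for `s ≥ 3`,
  `T ∖ (T □ C) ⊆ TPinch 0 0 s s` (`n = s+1`, `N = 2s`): at most two closed crossing clusters by the previous item and a
  pigeonhole over three closed crossings, at most two open ones by `three_closed_of_three_open` (`…TPinchAlternation`),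
  at least two of each from the crossings and their frontier chains.
* `TPinchPos.not_mem_armEvent_of_six_crossings` — the six long-way crossings of the pieces of the hexagonal annulus
  `5k ≤ |·| ≤ 7k` (an open circuit of odd crossing parity, `exists_circuit_of_crossings`) exclude every closed crossing
  from `|·| = n < 5k` to `|·| = N > 7k`.

Pure combinatorics; no probability, no definitions, no named facts.
-/

noncomputable section

namespace Summit.CriticalPhenomena.CardyFormulaZ2.Cruxes.NestingRigidity.PinchResampling

open Set Literature.Probability.Percolation Literature.Probability.LatticeModels
open scoped Literature.Probability.Percolation

namespace TPinchPos

variable {n N : ℕ} {ω : SiteConfig (Site 2)}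

/-! ### The two tree events as `𝕋`-paths of coloured sites of `triAnn n N` -/

/-- The closed sites of the annulus, as written in `mem_armEvent_one_iff_exists_pathIn`. -/
theorem setOf_inter_iff_false_eq (n N : ℕ) (ω : SiteConfig (Site 2)) :
    {v : Site 2 | (n : ℤ) ≤ triNorm v ∧ triNorm v ≤ N} ∩ {v | v ∈ ω ↔ false} = triAnn n N \ ω := by
  ext v
  simp

/-- A closed crossing of `{n ≤ |·| ≤ N}` as a closed arm. -/
theorem mem_armEvent_false_of_pathIn (hnN : n ≤ N) {a b : Site 2} (ha : triNorm a = n) (hb : triNorm b = N)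
    (h : PathIn triGraph (triAnn n N \ ω) a b) : ω ∈ armEvent ![false] n N :=
  (mem_armEvent_one_iff_exists_pathIn hnN).2
    ⟨a, mem_triSphere_iff.2 ha, b, mem_triSphere_iff.2 hb, by rwa [setOf_inter_iff_false_eq]⟩

/-- A closed arm as a closed crossing of `{n ≤ |·| ≤ N}`. -/
theorem exists_pathIn_of_mem_armEvent_false (hnN : n ≤ N) (h : ω ∈ armEvent ![false] n N) :
    ∃ a b : Site 2, triNorm a = n ∧ triNorm b = N ∧ PathIn triGraph (triAnn n N \ ω) a b := by
  obtain ⟨a, ha, b, hb, hp⟩ := (mem_armEvent_one_iff_exists_pathIn hnN).1 h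
  exact ⟨a, b, mem_triSphere_iff.1 ha, mem_triSphere_iff.1 hb, by rwa [setOf_inter_iff_false_eq] at hp⟩

/-- **Two open crossing clusters, as `𝕋`-paths**: the data of `TFourArmTwoClusters 0 n N` (`n < N`). -/
theorem exists_of_mem_tFourArmTwoClusters_zero (hnN : n < N) (hT : ω ∈ TFourArmTwoClusters 0 n N) :
    ∃ s₁ t₁ s₂ t₂ : Site 2, triNorm s₁ = n ∧ triNorm t₁ = N ∧ triNorm s₂ = n ∧ triNorm t₂ = N ∧
      PathIn triGraph (triAnn n N ∩ ω) s₁ t₁ ∧ PathIn triGraph (triAnn n N ∩ ω) s₂ t₂ ∧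
      ¬ PathIn triGraph (triAnn n N ∩ ω) s₁ s₂ := by
  obtain ⟨p₁, q₁, p₂, q₂, hp₁, hq₁, hp₂, hq₂, hP₁, hP₂, hsep⟩ := hT
  rw [tAnnulus_zero_eq_triAnn] at hP₁ hP₂ hsep
  rw [sub_zero] at hp₁ hq₁ hp₂ hq₂
  have hne : ∀ {p q : Site 2}, triNorm p = n → triNorm q = N → p ≠ q := by
    rintro p q hp hq rfl; omega
  have hp₁ω : p₁ ∈ ω := by
    rw [tColourGraph_true] at hP₁; exact NeckCoarse.mem_of_pathIn_ne hP₁ (hne hp₁ hq₁)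
  have hp₂ω : p₂ ∈ ω := by
    rw [tColourGraph_true] at hP₂; exact NeckCoarse.mem_of_pathIn_ne hP₂ (hne hp₂ hq₂)
  exact ⟨p₁, q₁, p₂, q₂, hp₁, hq₁, hp₂, hq₂, NeckCoarse.pathIn_inter_of_pathIn_open hP₁ hp₁ω,
    NeckCoarse.pathIn_inter_of_pathIn_open hP₂ hp₂ω, fun h ↦ hsep (NeckCoarse.pathIn_open_of_pathIn_inter h)⟩

/-- **`𝕋`-paths as two open crossing clusters**: the converse packaging. -/
theorem mem_tFourArmTwoClusters_zero_of {s₁ t₁ s₂ t₂ : Site 2} (hs₁ : triNorm s₁ = n) (ht₁ : triNorm t₁ = N)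
    (hs₂ : triNorm s₂ = n) (ht₂ : triNorm t₂ = N) (hB₁ : PathIn triGraph (triAnn n N ∩ ω) s₁ t₁)
    (hB₂ : PathIn triGraph (triAnn n N ∩ ω) s₂ t₂) (hsep : ¬ PathIn triGraph (triAnn n N ∩ ω) s₁ s₂) :
    ω ∈ TFourArmTwoClusters 0 n N := by
  refine ⟨s₁, t₁, s₂, t₂, by rwa [sub_zero], by rwa [sub_zero], by rwa [sub_zero], by rwa [sub_zero], ?_, ?_, ?_⟩
  · rw [tAnnulus_zero_eq_triAnn]; exact NeckCoarse.pathIn_open_of_pathIn_inter hB₁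
  · rw [tAnnulus_zero_eq_triAnn]; exact NeckCoarse.pathIn_open_of_pathIn_inter hB₂
  · rw [tAnnulus_zero_eq_triAnn]; exact fun h ↦ hsep (NeckCoarse.pathIn_inter_of_pathIn_open h hB₁.left_mem.2)

/-! ### Disjoint occurrence of a third closed crossing -/

/-- **The certificate.**  On the annulus `A = {n ≤ |·| ≤ N}` (`1 ≤ n`, `n + 2 ≤ N`), let `s₁ ⇝ t₁`, `s₂ ⇝ t₂` be open
crossings not joined by an open path of `A`, `F` frontier chains of the cluster of `s₁` facing `s₂` in the certified
order `τ₁ < t₂ < τ₂ < t₁`, and `v ⇝ w` a closed crossing joined by closed paths of `A` to neither `τ₁` nor `τ₂`.  Then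
`T □ C` occurs: the sites of the two open crossings and of the two chains certify `T` (in any configuration agreeing
there, an open path `s₁ ⇝ s₂` of `A` would interleave, on `∂Λ_N`, with the closed-and-hole path
`τ₁ ⇝ σ₁ → hole → σ₂ ⇝ τ₂`), the sites of `v ⇝ w` certify `C`, and the two site sets are disjoint. -/
theorem mem_disjointOccurrence_of_third (hn : 1 ≤ n) (hnN : n + 2 ≤ N) {s₁ t₁ s₂ t₂ : Site 2}
    (hB₁ : PathIn triGraph (triAnn n N ∩ ω) s₁ t₁) (hs₁ : triNorm s₁ = n) (ht₁ : triNorm t₁ = N)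
    (hB₂ : PathIn triGraph (triAnn n N ∩ ω) s₂ t₂) (hs₂ : triNorm s₂ = n) (ht₂ : triNorm t₂ = N)
    (F : FrontierChains n N ω s₁ s₂)
    (h0 : 0 < hexShift N F.τ₁ t₂) (h1 : hexShift N F.τ₁ t₂ < hexShift N F.τ₁ F.τ₂)
    (h2 : hexShift N F.τ₁ F.τ₂ < hexShift N F.τ₁ t₁)
    {v w : Site 2} (hv : triNorm v = n) (hw : triNorm w = N) (hζ : PathIn triGraph (triAnn n N \ ω) v w)
    (hv₁ : ¬ PathIn triGraph (triAnn n N \ ω) v F.τ₁) (hv₂ : ¬ PathIn triGraph (triAnn n N \ ω) v F.τ₂) :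
    ω ∈ TFourArmTwoClusters 0 n N □ armEvent ![false] n N := by
  have hN : 1 ≤ N := by omega
  obtain ⟨S₁, hS₁, hP₁, -⟩ := hB₁.exists_support
  obtain ⟨S₂, hS₂, hP₂, -⟩ := hB₂.exists_support
  obtain ⟨D₁, hD₁, hQ₁, hD₁t⟩ := F.chain₁.exists_support
  obtain ⟨D₂, hD₂, hQ₂, hD₂t⟩ := F.chain₂.exists_support
  obtain ⟨Z, hZ, hR, hZt⟩ := hζ.exists_support
  have hD₁c : D₁ ⊆ triAnn n N \ ω := hD₁.trans annFrontier_subset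
  have hD₂c : D₂ ⊆ triAnn n N \ ω := hD₂.trans annFrontier_subset
  refine ⟨S₁ ∪ S₂ ∪ D₁ ∪ D₂, Z, ?_, fun ω' hω' ↦ ?_, fun ω' hω' ↦ ?_⟩
  · -- disjointness of the witness sets
    rw [Set.disjoint_left]
    rintro z (((hz | hz) | hz) | hz) hzZ
    · exact (hZ hzZ).2 (hS₁ hz).2
    · exact (hZ hzZ).2 (hS₂ hz).2
    · exact hv₁ (((hZt z hzZ).mono hZ).trans (((hD₁t z hz).symm.trans hQ₁).mono hD₁c))
    · exact hv₂ (((hZt z hzZ).mono hZ).trans ((hD₂t z hz).symm.mono hD₂c))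
  · -- the open crossings and the chains certify `T`
    have agree : ∀ z ∈ S₁ ∪ S₂ ∪ D₁ ∪ D₂, z ∈ ω' ↔ z ∈ ω := hω'
    have hB₁' : PathIn triGraph (triAnn n N ∩ ω') s₁ t₁ :=
      hP₁.mono fun z hz ↦ ⟨(hS₁ hz).1, (agree z (Or.inl (Or.inl (Or.inl hz)))).2 (hS₁ hz).2⟩
    have hB₂' : PathIn triGraph (triAnn n N ∩ ω') s₂ t₂ :=
      hP₂.mono fun z hz ↦ ⟨(hS₂ hz).1, (agree z (Or.inl (Or.inl (Or.inr hz)))).2 (hS₂ hz).2⟩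
    have hd₁' : PathIn triGraph (triAnn n N \ ω') F.σ₁ F.τ₁ :=
      hQ₁.mono fun z hz ↦ ⟨(hD₁c hz).1, fun h ↦ (hD₁c hz).2 ((agree z (Or.inl (Or.inr hz))).1 h)⟩
    have hd₂' : PathIn triGraph (triAnn n N \ ω') F.τ₂ F.σ₂ :=
      hQ₂.mono fun z hz ↦ ⟨(hD₂c hz).1, fun h ↦ (hD₂c hz).2 ((agree z (Or.inr hz)).1 h)⟩
    refine mem_tFourArmTwoClusters_zero_of hs₁ ht₁ hs₂ ht₂ hB₁' hB₂' fun hP ↦ ?_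
    -- the closed-and-hole path `τ₁ ⇝ τ₂` against the open path `t₂ ⇝ t₁`
    set B : Set (Site 2) := {z | z ∈ triAnn n N \ ω' ∨ triNorm z < n} with hB
    have hPc : PathIn triGraph ((↑(triBall N) : Set (Site 2)) ∩ B) F.τ₁ F.τ₂ :=
      holeBridge hn (by omega) (X := triAnn n N \ ω') Set.sdiff_subset hd₁' F.norm_σ₁ hd₂'.symm F.norm_σ₂
    have hQo : PathIn triGraph ((↑(triBall N) : Set (Site 2)) ∩ Bᶜ) t₂ t₁ :=
      ((hB₂'.symm.trans hP.symm).trans hB₁').mono fun z hz ↦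
        ⟨Finset.mem_coe.2 (mem_triBall_iff.2 (mem_triAnn.1 hz.1).2), fun h ↦ by
          rcases h with h | h
          · exact h.2 hz.2
          · have := (mem_triAnn.1 hz.1).1; omega⟩
    exact triBall_not_interleaved_shift hN B F.norm_τ₁ F.norm_τ₁ ht₂ F.norm_τ₂ ht₁
      (by rw [hexShift_self]; exact h0) h1 h2 hPc hQo
  · -- the third crossing certifies `C`
    have agree : ∀ z ∈ Z, z ∈ ω' ↔ z ∈ ω := hω'
    exact mem_armEvent_false_of_pathIn (by omega) hv hw
      (hR.mono fun z hz ↦ ⟨(hZ hz).1, fun h ↦ (hZ hz).2 ((agree z hz).1 h)⟩)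

/-- **Pigeonhole**: among three sites pairwise not joined inside `A`, one is joined to neither of two given sites
(each given site is joined to at most one of the three). -/
theorem exists_third {A : Set (Site 2)} {P : Site 2 → Prop} {v₁ v₂ v₃ τ₁ τ₂ : Site 2} (hp₁ : P v₁) (hp₂ : P v₂)
    (hp₃ : P v₃) (h12 : ¬ PathIn triGraph A v₁ v₂) (h13 : ¬ PathIn triGraph A v₁ v₃) (h23 : ¬ PathIn triGraph A v₂ v₃) :
    ∃ v, P v ∧ ¬ PathIn triGraph A v τ₁ ∧ ¬ PathIn triGraph A v τ₂ := by
  by_cases hJ₁ : PathIn triGraph A v₁ τ₁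
  · have hJ₂ : ¬ PathIn triGraph A v₂ τ₁ := fun h ↦ h12 (hJ₁.trans h.symm)
    have hJ₃ : ¬ PathIn triGraph A v₃ τ₁ := fun h ↦ h13 (hJ₁.trans h.symm)
    by_cases hK₂ : PathIn triGraph A v₂ τ₂
    · exact ⟨v₃, hp₃, hJ₃, fun h ↦ h23 (hK₂.trans h.symm)⟩
    · exact ⟨v₂, hp₂, hJ₂, hK₂⟩
  · by_cases hK₁ : PathIn triGraph A v₁ τ₂
    · have hK₂ : ¬ PathIn triGraph A v₂ τ₂ := fun h ↦ h12 (hK₁.trans h.symm)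
      have hK₃ : ¬ PathIn triGraph A v₃ τ₂ := fun h ↦ h13 (hK₁.trans h.symm)
      by_cases hJ₂ : PathIn triGraph A v₂ τ₁
      · exact ⟨v₃, hp₃, fun h ↦ h23 (hJ₂.trans h.symm), hK₃⟩
      · exact ⟨v₂, hp₂, hJ₂, hK₂⟩
    · exact ⟨v₁, hp₁, hJ₁, hK₁⟩

/-! ### The collar `Λ_{2s} ∖ Λ_s` at the origin: layers and coloured paths -/

variable {s : ℕ}

/-- The collar of `TPinch 0 0 s s` is the annulus `{s+1 ≤ |·| ≤ 2s}`. -/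
theorem tBall_zero_sdiff (s : ℕ) : tBall 0 (2 * s) \ tBall 0 s = triAnn (s + 1) (2 * s) := by
  ext v
  simp only [tBall, Set.mem_sdiff, mem_setOf_eq, sub_zero, mem_triAnn, not_le]
  push_cast
  omega

/-- Sites of the inner layer of the collar have norm `s + 1`. -/
theorem triNorm_of_mem_innerLayer {v : Site 2} (hv : v ∈ innerLayer triGraph (tBall 0 s) (tBall 0 (2 * s))) :
    triNorm v = (s + 1 : ℕ) := by
  have h1 := triNorm_le_of_mem_innerLayer hv
  have h2 : v ∈ tBall 0 (2 * s) \ tBall 0 s := hv.1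
  rw [tBall_zero_sdiff, mem_triAnn] at h2
  rw [sub_zero] at h1
  push_cast at h2
  omega

/-- Sites of norm `s + 1` lie on the inner layer of the collar (`s ≥ 1`). -/
theorem mem_innerLayer_of_triNorm (hs : 1 ≤ s) {v : Site 2} (hv : triNorm v = (s + 1 : ℕ)) :
    v ∈ innerLayer triGraph (tBall 0 s) (tBall 0 (2 * s)) := by
  obtain ⟨h, hadj, hh⟩ := exists_adj_mem_triBall_sub_one (r := s + 1) (by omega) hv
  refine ⟨?_, h, ?_, hadj⟩
  · rw [tBall_zero_sdiff, mem_triAnn]; push_cast at hv ⊢; omega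
  · simp only [tBall, mem_setOf_eq, sub_zero]
    have : (s + 1 - 1 : ℕ) = s := by omega
    rw [this] at hh
    exact hh

/-- Sites of the outer layer of the collar have norm `2s`. -/
theorem triNorm_of_mem_outerLayer {v : Site 2} (hv : v ∈ outerLayer triGraph (tBall 0 s) (tBall 0 (2 * s))) :
    triNorm v = (2 * s : ℕ) := by
  have h1 := le_triNorm_of_mem_outerLayer hv
  have h2 : v ∈ tBall 0 (2 * s) \ tBall 0 s := hv.1
  rw [tBall_zero_sdiff, mem_triAnn] at h2
  rw [sub_zero] at h1
  push_cast at h1 h2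
  omega

/-- Sites of norm `2s` lie on the outer layer of the collar (`s ≥ 1`). -/
theorem mem_outerLayer_of_triNorm (hs : 1 ≤ s) {v : Site 2} (hv : triNorm v = (2 * s : ℕ)) :
    v ∈ outerLayer triGraph (tBall 0 s) (tBall 0 (2 * s)) := by
  obtain ⟨z, hadj, hz⟩ := exists_adj_triNorm_eq_add_one v
  push_cast at hv
  refine ⟨?_, z, ?_, hadj⟩
  · rw [tBall_zero_sdiff, mem_triAnn]; push_cast; omega
  · simp only [tBall, mem_setOf_eq, sub_zero, not_le]; push_cast; omega

/-- The closed colour graph of `ω` is the open graph of `ωᶜ`. -/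
theorem tColourGraph_false (ω : SiteConfig (Site 2)) : tColourGraph ω false = siteOpenGraph triGraph ωᶜ := by
  have h : {u : Site 2 | (u ∈ ω) = false} = ωᶜ := by ext u; simp
  rw [tColourGraph, h]

/-- A path of the closed graph from a closed site is a `𝕋`-path of closed sites. -/
theorem pathIn_diff_of_pathIn_closed {A : Set (Site 2)} {u v : Site 2} (h : PathIn (tColourGraph ω false) A u v)
    (hu : u ∉ ω) : PathIn triGraph (A \ ω) u v := by
  have h' : PathIn (tColourGraph ωᶜ true) A u v := by rwa [tColourGraph_true, ← tColourGraph_false]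
  rw [Set.sdiff_eq]
  exact NeckCoarse.pathIn_inter_of_pathIn_open h' hu

/-- A `𝕋`-path of closed sites is a path of the closed graph. -/
theorem pathIn_closed_of_pathIn_diff {A : Set (Site 2)} {u v : Site 2} (h : PathIn triGraph (A \ ω) u v) :
    PathIn (tColourGraph ω false) A u v := by
  rw [tColourGraph_false, ← tColourGraph_true]
  rw [Set.sdiff_eq] at h
  exact NeckCoarse.pathIn_open_of_pathIn_inter h

/-- **An open crossing of the collar in cluster form is an open crossing of `{s+1 ≤ |·| ≤ 2s}`** (`s ≥ 2`). -/
theorem exists_of_isCrossing_true (hs : 2 ≤ s) {v : Site 2}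
    (hv : IsCrossing triGraph (tColourGraph ω true) (tBall 0 s) (tBall 0 (2 * s)) v) :
    ∃ w, triNorm v = (s + 1 : ℕ) ∧ triNorm w = (2 * s : ℕ) ∧ PathIn triGraph (triAnn (s + 1) (2 * s) ∩ ω) v w := by
  obtain ⟨hin, w, hw, hp⟩ := hv
  have hvn := triNorm_of_mem_innerLayer hin
  have hwn := triNorm_of_mem_outerLayer hw
  rw [tBall_zero_sdiff] at hp
  have hne : v ≠ w := by rintro rfl; push_cast at hvn hwn; omega
  have hvω : v ∈ ω := by rw [tColourGraph_true] at hp; exact NeckCoarse.mem_of_pathIn_ne hp hne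
  exact ⟨w, hvn, hwn, NeckCoarse.pathIn_inter_of_pathIn_open hp hvω⟩

/-- **A closed crossing of the collar in cluster form is a closed crossing of `{s+1 ≤ |·| ≤ 2s}`** (`s ≥ 2`). -/
theorem exists_of_isCrossing_false (hs : 2 ≤ s) {v : Site 2}
    (hv : IsCrossing triGraph (tColourGraph ω false) (tBall 0 s) (tBall 0 (2 * s)) v) :
    ∃ w, triNorm v = (s + 1 : ℕ) ∧ triNorm w = (2 * s : ℕ) ∧ PathIn triGraph (triAnn (s + 1) (2 * s) \ ω) v w := by
  obtain ⟨hin, w, hw, hp⟩ := hv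
  have hvn := triNorm_of_mem_innerLayer hin
  have hwn := triNorm_of_mem_outerLayer hw
  rw [tBall_zero_sdiff] at hp
  have hne : v ≠ w := by rintro rfl; push_cast at hvn hwn; omega
  have hvω : v ∉ ω := by
    rw [tColourGraph_false] at hp
    exact NeckCoarse.mem_of_pathIn_ne hp hne
  exact ⟨w, hvn, hwn, pathIn_diff_of_pathIn_closed hp hvω⟩

/-- An open crossing of `{s+1 ≤ |·| ≤ 2s}` is an open crossing of the collar in cluster form (`s ≥ 1`). -/
theorem isCrossing_true_of (hs : 1 ≤ s) {v w : Site 2} (hv : triNorm v = (s + 1 : ℕ)) (hw : triNorm w = (2 * s : ℕ))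
    (hp : PathIn triGraph (triAnn (s + 1) (2 * s) ∩ ω) v w) :
    IsCrossing triGraph (tColourGraph ω true) (tBall 0 s) (tBall 0 (2 * s)) v :=
  ⟨mem_innerLayer_of_triNorm hs hv, w, mem_outerLayer_of_triNorm hs hw, by
    rw [tBall_zero_sdiff]; exact NeckCoarse.pathIn_open_of_pathIn_inter hp⟩

/-- A closed crossing of `{s+1 ≤ |·| ≤ 2s}` is a closed crossing of the collar in cluster form (`s ≥ 1`). -/
theorem isCrossing_false_of (hs : 1 ≤ s) {v w : Site 2} (hv : triNorm v = (s + 1 : ℕ)) (hw : triNorm w = (2 * s : ℕ))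
    (hp : PathIn triGraph (triAnn (s + 1) (2 * s) \ ω) v w) :
    IsCrossing triGraph (tColourGraph ω false) (tBall 0 s) (tBall 0 (2 * s)) v :=
  ⟨mem_innerLayer_of_triNorm hs hv, w, mem_outerLayer_of_triNorm hs hw, by
    rw [tBall_zero_sdiff]; exact pathIn_closed_of_pathIn_diff hp⟩

/-! ### The deterministic inclusion -/

/-- **At most two closed crossing clusters** of the collar on `T ∖ (T □ C)` (`s ≥ 3`): among three closed crossings
pairwise not joined by closed paths, one is joined to neither frontier chain of the two open crossings, and then the
disjoint occurrence would hold (`mem_disjointOccurrence_of_third`). -/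
theorem closed_two (hs : 3 ≤ s) (hT : ω ∈ TFourArmTwoClusters 0 (s + 1) (2 * s))
    (hD : ω ∉ TFourArmTwoClusters 0 (s + 1) (2 * s) □ armEvent ![false] (s + 1) (2 * s)) (v₁ v₂ v₃ : Site 2)
    (hc₁ : IsCrossing triGraph (tColourGraph ω false) (tBall 0 s) (tBall 0 (2 * s)) v₁)
    (hc₂ : IsCrossing triGraph (tColourGraph ω false) (tBall 0 s) (tBall 0 (2 * s)) v₂)
    (hc₃ : IsCrossing triGraph (tColourGraph ω false) (tBall 0 s) (tBall 0 (2 * s)) v₃) :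
    PathIn (tColourGraph ω false) (tBall 0 (2 * s) \ tBall 0 s) v₁ v₂ ∨
      PathIn (tColourGraph ω false) (tBall 0 (2 * s) \ tBall 0 s) v₁ v₃ ∨
      PathIn (tColourGraph ω false) (tBall 0 (2 * s) \ tBall 0 s) v₂ v₃ := by
  by_contra hcon
  simp only [not_or] at hcon
  obtain ⟨n12, n13, n23⟩ := hcon
  obtain ⟨s₁, t₁, s₂, t₂, hs₁, ht₁, hs₂, ht₂, hB₁, hB₂, hsep⟩ := exists_of_mem_tFourArmTwoClusters_zero (by omega) hT
  obtain ⟨F, -, h0, h1, h2⟩ :=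
    exists_frontierChains_alternating (n := s + 1) (N := 2 * s) (by omega) (by omega) hB₁ hs₁ ht₁ hB₂ hs₂ ht₂ hsep
  have lift : ∀ {a b : Site 2}, PathIn triGraph (triAnn (s + 1) (2 * s) \ ω) a b →
      PathIn (tColourGraph ω false) (tBall 0 (2 * s) \ tBall 0 s) a b := fun h ↦ by
    rw [tBall_zero_sdiff]; exact pathIn_closed_of_pathIn_diff h
  obtain ⟨v, ⟨w, hv, hw, hζ⟩, hvτ₁, hvτ₂⟩ := exists_third (τ₁ := F.τ₁) (τ₂ := F.τ₂)
    (P := fun v ↦ ∃ w, triNorm v = (s + 1 : ℕ) ∧ triNorm w = (2 * s : ℕ) ∧ PathIn triGraph (triAnn (s + 1) (2 * s) \ ω) v w)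
    (exists_of_isCrossing_false (by omega) hc₁) (exists_of_isCrossing_false (by omega) hc₂)
    (exists_of_isCrossing_false (by omega) hc₃)
    (fun h ↦ n12 (lift h)) (fun h ↦ n13 (lift h)) (fun h ↦ n23 (lift h))
  exact hD (mem_disjointOccurrence_of_third (by omega) (by omega) hB₁ hs₁ ht₁ hB₂ hs₂ ht₂ F h0 h1 h2 hv hw hζ hvτ₁ hvτ₂)

/-- **At most two open crossing clusters** of the collar on `T ∖ (T □ C)` (`s ≥ 3`): three open crossing clusters would
force three closed ones (`three_closed_of_three_open`), against `closed_two`. -/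
theorem open_two (hs : 3 ≤ s) (hT : ω ∈ TFourArmTwoClusters 0 (s + 1) (2 * s))
    (hD : ω ∉ TFourArmTwoClusters 0 (s + 1) (2 * s) □ armEvent ![false] (s + 1) (2 * s)) (v₁ v₂ v₃ : Site 2)
    (hc₁ : IsCrossing triGraph (tColourGraph ω true) (tBall 0 s) (tBall 0 (2 * s)) v₁)
    (hc₂ : IsCrossing triGraph (tColourGraph ω true) (tBall 0 s) (tBall 0 (2 * s)) v₂)
    (hc₃ : IsCrossing triGraph (tColourGraph ω true) (tBall 0 s) (tBall 0 (2 * s)) v₃) :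
    PathIn (tColourGraph ω true) (tBall 0 (2 * s) \ tBall 0 s) v₁ v₂ ∨
      PathIn (tColourGraph ω true) (tBall 0 (2 * s) \ tBall 0 s) v₁ v₃ ∨
      PathIn (tColourGraph ω true) (tBall 0 (2 * s) \ tBall 0 s) v₂ v₃ := by
  by_contra hcon
  simp only [not_or] at hcon
  obtain ⟨n12, n13, n23⟩ := hcon
  have lift : ∀ {a b : Site 2}, PathIn triGraph (triAnn (s + 1) (2 * s) ∩ ω) a b →
      PathIn (tColourGraph ω true) (tBall 0 (2 * s) \ tBall 0 s) a b := fun h ↦ by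
    rw [tBall_zero_sdiff]; exact NeckCoarse.pathIn_open_of_pathIn_inter h
  obtain ⟨w₁, hv₁, hw₁, hB₁⟩ := exists_of_isCrossing_true (by omega) hc₁
  obtain ⟨w₂, hv₂, hw₂, hB₂⟩ := exists_of_isCrossing_true (by omega) hc₂
  obtain ⟨w₃, hv₃, hw₃, hB₃⟩ := exists_of_isCrossing_true (by omega) hc₃
  obtain ⟨x₁, y₁, x₂, y₂, x₃, y₃, hx₁, hy₁, hx₂, hy₂, hx₃, hy₃, e₁, e₂, e₃, m12, m13, m23⟩ :=
    three_closed_of_three_open (by omega) (by omega) hB₁ hv₁ hw₁ hB₂ hv₂ hw₂ hB₃ hv₃ hw₃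
      (fun h ↦ n12 (lift h)) (fun h ↦ n13 (lift h)) (fun h ↦ n23 (lift h))
  have drop : ∀ {a b : Site 2}, a ∉ ω → PathIn (tColourGraph ω false) (tBall 0 (2 * s) \ tBall 0 s) a b →
      PathIn triGraph (triAnn (s + 1) (2 * s) \ ω) a b := fun ha h ↦ by
    rw [tBall_zero_sdiff] at h; exact pathIn_diff_of_pathIn_closed h ha
  rcases closed_two hs hT hD x₁ x₂ x₃ (isCrossing_false_of (by omega) hx₁ hy₁ e₁)
    (isCrossing_false_of (by omega) hx₂ hy₂ e₂) (isCrossing_false_of (by omega) hx₃ hy₃ e₃) with h | h | h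
  · exact m12 (e₁.symm.trans ((drop e₁.left_mem.2 h).trans e₂))
  · exact m13 (e₁.symm.trans ((drop e₁.left_mem.2 h).trans e₃))
  · exact m23 (e₂.symm.trans ((drop e₂.left_mem.2 h).trans e₃))

/-- **The deterministic half of (I0).**  For `s ≥ 3`, a configuration with two open crossing clusters of the collar
`{s+1 ≤ |·| ≤ 2s}` in which `T □ C` (a third, DISJOINT closed crossing) does not occur lies in `TPinch 0 0 s s`:
exactly two open and exactly two closed crossing clusters of `Λ_{2s} ∖ Λ_s`. -/
theorem tPinch_zero_of_not_mem_disjointOccurrence (hs : 3 ≤ s) (hT : ω ∈ TFourArmTwoClusters 0 (s + 1) (2 * s))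
    (hD : ω ∉ TFourArmTwoClusters 0 (s + 1) (2 * s) □ armEvent ![false] (s + 1) (2 * s)) : ω ∈ TPinch 0 0 s s := by
  obtain ⟨s₁, t₁, s₂, t₂, hs₁, ht₁, hs₂, ht₂, hB₁, hB₂, hsep⟩ := exists_of_mem_tFourArmTwoClusters_zero (by omega) hT
  obtain ⟨F, hnj, -, -, -⟩ :=
    exists_frontierChains_alternating (n := s + 1) (N := 2 * s) (by omega) (by omega) hB₁ hs₁ ht₁ hB₂ hs₂ ht₂ hsep
  have d₁ : PathIn triGraph (triAnn (s + 1) (2 * s) \ ω) F.σ₁ F.τ₁ := F.chain₁.mono annFrontier_subset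
  have d₂ : PathIn triGraph (triAnn (s + 1) (2 * s) \ ω) F.σ₂ F.τ₂ := (F.chain₂.mono annFrontier_subset).symm
  refine ⟨⟨⟨s₁, s₂, isCrossing_true_of (by omega) hs₁ ht₁ hB₁, isCrossing_true_of (by omega) hs₂ ht₂ hB₂,
    fun h ↦ hsep ?_⟩, open_two hs hT hD⟩,
    ⟨⟨F.σ₁, F.σ₂, isCrossing_false_of (by omega) F.norm_σ₁ F.norm_τ₁ d₁,
      isCrossing_false_of (by omega) F.norm_σ₂ F.norm_τ₂ d₂, fun h ↦ hnj ?_⟩, closed_two hs hT hD⟩⟩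
  · rw [tBall_zero_sdiff] at h
    exact NeckCoarse.pathIn_inter_of_pathIn_open h hB₁.left_mem.2
  · rw [tBall_zero_sdiff] at h
    exact d₁.symm.trans ((pathIn_diff_of_pathIn_closed h d₁.left_mem.2).trans d₂)

/-! ### Open circuits exclude closed crossings -/

/-- **Six long-way crossings of the pieces of `5k ≤ |·| ≤ 7k` exclude closed arms from `∂Λ_n` to `∂Λ_N`** when
`n < 5k` and `7k < N`: the open circuit of `exists_circuit_of_crossings` has crossing parity `1` at the start (joined
to the origin inside `|·| ≤ n`) and `0` at the end of the closed crossing, so the crossing meets it — at an open site. -/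
theorem not_mem_armEvent_of_six_crossings {k : ℕ} (hk : 1 ≤ k) (hnk : (n : ℤ) < 5 * k) (hkN : 7 * (k : ℤ) < N)
    (hω : ∀ j < 6, ω ∈ isoTBCrossing (pieceIso k j) k (7 * k)) : ω ∉ armEvent ![false] n N := by
  intro h
  obtain ⟨a, b, ha, hb, hζ⟩ := exists_pathIn_of_mem_armEvent_false (by omega) h
  obtain ⟨v, w, hw, h1⟩ := exists_circuit_of_crossings hk hω
  obtain ⟨q, hq⟩ := hζ.exists_walk
  obtain ⟨q₀, hq₀⟩ := exists_walk_to_zero a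
  have hpa : windParity w a = 1 := by
    rw [windParity_eq_of_walk w q₀ fun z hz hzw ↦ ?_, h1]
    have := hq₀ z hz
    have := (hw z hzw).2.1
    omega
  have hpb : windParity w b = 0 :=
    windParity_eq_zero_of_triNorm_lt w (T := 7 * k) (fun z hz ↦ by exact_mod_cast (hw z hz).2.2) (by push_cast; omega)
  obtain ⟨z, hzq, hzw⟩ := exists_mem_support_of_windParity_ne w (by rw [hpa, hpb]; decide) q
  exact (hq z hzq).2 (hw z hzw).1

end TPinchPos

/-- **Anchor (stub S11 helper, input (I0)): the deterministic half of the positivity of the selection event** — for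
`s ≥ 3`, two open crossing clusters of `{s+1 ≤ |·| ≤ 2s}` without a disjointly occurring third closed crossing give
`TPinch 0 0 s s` (`TPinchPos.tPinch_zero_of_not_mem_disjointOccurrence`). -/
theorem tPinch_zero_of_twoClusters : ∀ (s : ℕ) (ω : SiteConfig (Site 2)), 3 ≤ s → ω ∈ TFourArmTwoClusters 0 (s + 1) (2 * s) → ω ∉ disjointOccurrence (TFourArmTwoClusters 0 (s + 1) (2 * s)) (armEvent ![false] (s + 1) (2 * s)) → ω ∈ TPinch 0 0 s s :=
  fun _ _ hs hT hD ↦ TPinchPos.tPinch_zero_of_not_mem_disjointOccurrence hs hT hD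

end Summit.CriticalPhenomena.CardyFormulaZ2.Cruxes.NestingRigidity.PinchResampling

end
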